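import Summits.AtomisticToContinuum.Crystallization.Theorems.ChessboardParticlePlanesLjPlaneChessboardLayerCosets

/-!
# Crux `ChessboardParticlePlanes.LjPlaneChessboard` (stmt-AtomisticToContinuum-6709), line `Sketch`,
# stub `layerPresentation_periodic` — a vertically periodic presentation of all layers

Let `Q` be a periodic configuration of `ℝ³` (motif `F`, periods `G`, point set `F + G`), let
`a, b ∈ G` be horizontal periods (`a 2 = b 2 = 0`) such that every horizontal period is an integer
combination `k a + l b`, let `g₀ ∈ G` be a period, and let `z : ℤ → ℝ` be the strictly increasing
enumeration of the occupied heights, with `n ≥ 1` planes per vertical period: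
`z (i + n) = z i + g₀ 2`.  Then there is ONE family `F m` (`m ∈ ℤ`) of layer motifs — at most `#F`
points of `Q` of height `z m`, pairwise inequivalent modulo `ℤa + ℤb`, whose cosets
`f + ℤa + ℤb` exhaust the plane `{x₂ = z m} ∩ (F + G)` — which is moreover vertically periodic:
`F (m + n) = F m + g₀`. [folklore]

PROOF.  The landed stub `layerCosets` provides such a motif `G t` for every single height `t`.
Writing `m = n q + r` with `0 ≤ r < n` (`q = m / n`, `r = m % n`), put
`F m = G (z r) + q • g₀`.  Iterating the period rule gives `z m = z r + q · g₀ 2`, so the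
translate `G (z r) + q g₀` consists of points (`q g₀ ∈ G`) of height `z m`; pairwise inequivalence
modulo `ℤa + ℤb` and the coset decomposition of the plane are transported by the translation
`y ↦ y - q g₀`, which maps the plane at height `z m` inside `F + G` onto the plane at height `z r`.
Finally `m + n = n (q + 1) + r`, so `F (m + n) = G (z r) + (q + 1) g₀ = F m + g₀`.

No definition and no notation is introduced; strict monotonicity of `z` and the covering of the
occupied heights by `z` (parts of the registered signature) are not needed.
-/

noncomputable section

namespace Summit.AtomisticToContinuum.Crystallization.Theorems.ChessboardParticlePlanesLjPlaneChessboard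

open Literature.MathematicalPhysics.StatisticalMechanics

section LayerPresentation

/-- Iterating a period rule: if `z (i + N) = z i + c` for all `i`, then `z (i + k N) = z i + k c`
for all integers `k`. [folklore] -/
theorem layerPresentation_iterate {z : ℤ → ℝ} {N : ℤ} {c : ℝ}
    (hz : ∀ i : ℤ, z (i + N) = z i + c) : ∀ k i : ℤ, z (i + k * N) = z i + (k : ℝ) * c := by
  intro k
  induction k using Int.induction_on with
  | zero => intro i; simp
  | succ k ih =>
    intro i
    have e : i + ((k : ℤ) + 1) * N = (i + (k : ℤ) * N) + N := by ring
    rw [e, hz, ih]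
    push_cast
    ring
  | pred k ih =>
    intro i
    have h := hz (i + (-(k : ℤ) - 1) * N)
    have e : i + (-(k : ℤ) - 1) * N + N = i + (-(k : ℤ)) * N := by ring
    rw [e, ih] at h
    push_cast at h ⊢
    linarith

/-- Height decomposition along the vertical period: `z m = z (m % N) + (m / N) c` when
`z (i + N) = z i + c`. [folklore] -/
theorem layerPresentation_height_split {z : ℤ → ℝ} {N : ℤ} {c : ℝ}
    (hz : ∀ i : ℤ, z (i + N) = z i + c) (m : ℤ) : z m = z (m % N) + ((m / N : ℤ) : ℝ) * c := by
  have h := layerPresentation_iterate hz (m / N) (m % N)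
  rwa [Int.emod_add_ediv_mul] at h

/-- The height of a translate by a real multiple of a vector: `(f + c • g) 2 = f 2 + c * g 2`.
[folklore] -/
theorem layerPresentation_height_add_smul (f g : EuclideanSpace ℝ (Fin 3)) (c : ℝ) :
    (f + c • g) 2 = f 2 + c * g 2 := by
  rw [PiLp.add_apply, PiLp.smul_apply, smul_eq_mul]

/-- Integer multiples `(q : ℝ) • g₀` of a period are periods. [folklore] -/
theorem layerPresentation_zsmul_mem {Q : PeriodicConfiguration 3} {g₀ : EuclideanSpace ℝ (Fin 3)}
    (hg₀ : g₀ ∈ Q.lattice) (q : ℤ) : (q : ℝ) • g₀ ∈ Q.lattice := by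
  rw [Int.cast_smul_eq_zsmul]
  exact Q.lattice.smul_mem q hg₀

end LayerPresentation

/-- **Stub `layerPresentation_periodic` — a vertically periodic presentation of all layers.**
For a periodic configuration `Q` of `ℝ³`, horizontal periods `a, b` generating all horizontal
periods over `ℤ`, a period `g₀` and an enumeration `z` of the occupied heights with `n ≥ 1` planes
per vertical period (`z (i + n) = z i + g₀ 2`), there is a family `F : ℤ → Finset` of layer motifs:
`#(F m) ≤ #motif`, every `f ∈ F m` is a point of `Q` of height `z m`, the `f ∈ F m` are pairwise
inequivalent modulo `ℤa + ℤb`, the plane `{x₂ = z m} ∩ Q.points` is the union of the cosets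
`f + ℤa + ℤb` (`f ∈ F m`), and `F (m + n) = F m + g₀`. [folklore] -/
theorem layerPresentation_periodic :
    ∀ (Q : PeriodicConfiguration 3) (a b g₀ : EuclideanSpace ℝ (Fin 3)) (z : ℤ → ℝ) (n : ℕ),
      a ∈ Q.lattice → b ∈ Q.lattice → a 2 = 0 → b 2 = 0 → LinearIndependent ℝ ![a, b] →
      (∀ g ∈ Q.lattice, g 2 = 0 → ∃ k l : ℤ, g = (k : ℝ) • a + (l : ℝ) • b) →
      g₀ ∈ Q.lattice → 0 < n → StrictMono z → (∀ i : ℤ, z (i + n) = z i + g₀ 2) →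
      (∀ y ∈ Q.points, ∃ i : ℤ, y 2 = z i) →
      ∃ F : ℤ → Finset (EuclideanSpace ℝ (Fin 3)),
        (∀ m : ℤ, (F m).card ≤ Q.motif.card) ∧
        (∀ m : ℤ, ∀ f ∈ F m, f 2 = z m ∧ f ∈ Q.points) ∧
        (∀ m : ℤ, ∀ f ∈ F m, ∀ f' ∈ F m, f ≠ f' → ∀ k l : ℤ, f' ≠ f + (k : ℝ) • a + (l : ℝ) • b) ∧
        (∀ (m : ℤ) (y : EuclideanSpace ℝ (Fin 3)),
          (y ∈ Q.points ∧ y 2 = z m) ↔ ∃ f ∈ F m, ∃ k l : ℤ, y = f + (k : ℝ) • a + (l : ℝ) • b) ∧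
        (∀ m : ℤ, F (m + n) = (F m).image (fun f => f + g₀)) := by
  intro Q a b g₀ z n ha hb ha2 hb2 hab hgen hg₀ hn _ hper _
  -- a motif `G t` of the plane `{x₂ = t} ∩ Q.points`, for every height `t`
  choose G hGcard hGmem hGinj hGchar using layerCosets Q a b ha hb ha2 hb2 hab hgen
  have hN0 : (n : ℤ) ≠ 0 := by exact_mod_cast hn.ne'
  -- height bookkeeping: `z m = z (m % n) + (m / n) · g₀ 2`
  have hsplit : ∀ m : ℤ, z m = z (m % n) + ((m / n : ℤ) : ℝ) * g₀ 2 :=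
    layerPresentation_height_split hper
  -- the shifted representatives are points of height `z m`
  have hmem : ∀ m : ℤ, ∀ f ∈ (G (z (m % n))).image (fun f => f + ((m / n : ℤ) : ℝ) • g₀),
      f 2 = z m ∧ f ∈ Q.points := by
    intro m f hf
    obtain ⟨f₀, hf₀, rfl⟩ := Finset.mem_image.1 hf
    obtain ⟨h2, hP⟩ := hGmem _ f₀ hf₀
    exact ⟨by rw [hsplit m, layerPresentation_height_add_smul, h2],
      Q.add_mem_points hP (layerPresentation_zsmul_mem hg₀ _)⟩
  refine ⟨fun m => (G (z (m % n))).image (fun f => f + ((m / n : ℤ) : ℝ) • g₀),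
    fun m => Finset.card_image_le.trans (hGcard _), hmem, ?_, ?_, ?_⟩
  · -- pairwise inequivalence modulo `ℤa + ℤb` is translation invariant
    intro m f hf f' hf' hne k l heq
    obtain ⟨f₀, hf₀, rfl⟩ := Finset.mem_image.1 hf
    obtain ⟨f₀', hf₀', rfl⟩ := Finset.mem_image.1 hf'
    refine hGinj _ f₀ hf₀ f₀' hf₀' (fun h => hne (by rw [h])) k l ?_
    rw [eq_sub_of_add_eq heq]
    abel
  · -- the plane at height `z m` is the union of the cosets of the shifted representatives
    intro m y
    constructor
    · rintro ⟨hy, hy2⟩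
      have hy' : y - ((m / n : ℤ) : ℝ) • g₀ ∈ Q.points := by
        rw [sub_eq_add_neg]
        exact Q.add_mem_points hy (Q.lattice.neg_mem (layerPresentation_zsmul_mem hg₀ _))
      have hy'2 : (y - ((m / n : ℤ) : ℝ) • g₀) 2 = z (m % n) := by
        rw [sub_eq_add_neg, ← neg_smul, layerPresentation_height_add_smul, hy2, hsplit m]
        ring
      obtain ⟨f₀, hf₀, k, l, hkl⟩ := (hGchar _ _).1 ⟨hy', hy'2⟩
      refine ⟨f₀ + ((m / n : ℤ) : ℝ) • g₀, Finset.mem_image_of_mem _ hf₀, k, l, ?_⟩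
      rw [← sub_add_cancel y (((m / n : ℤ) : ℝ) • g₀), hkl]
      abel
    · rintro ⟨f, hf, k, l, rfl⟩
      obtain ⟨hf2, hfP⟩ := hmem m f hf
      exact ⟨by rw [add_assoc]; exact Q.add_mem_points hfP (layerCosets_comb_mem ha hb k l),
        by rw [layerCosets_height ha2 hb2, hf2]⟩
  · -- vertical periodicity: layer `m + n` is layer `m` shifted by `g₀`
    intro m
    have h1 : (m + n) % (n : ℤ) = m % n := Int.add_emod_right m n
    have h2 : (m + n) / (n : ℤ) = m / n + 1 := by
      simpa using Int.add_mul_ediv_right m 1 hN0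
    simp only [h1, h2, Finset.image_image]
    congr 1
    funext f
    simp only [Function.comp_apply]
    push_cast
    rw [add_smul, one_smul, add_assoc]

end Summit.AtomisticToContinuum.Crystallization.Theorems.ChessboardParticlePlanesLjPlaneChessboard

end
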